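import Mathlib.Analysis.SpecificLimits.Normed
import Literature.Computability.AlgebraicComplexity.PrattTripartitionBounds
import Literature.Computability.AlgebraicComplexity.KroneckerRank
import Literature.Computability.AlgebraicComplexity.TensorRestrictionRank
import HarnessLib

/-!
# Pratt's Corollary 1.12 — proved ingredients and the reduction to Theorem 1.9

Topic `Computability/AlgebraicComplexity`; companion of `PrattTripartitionBounds.lean`, which
vendors K. Pratt, *A stronger connection between the asymptotic rank conjecture and the set cover
conjecture*, Proc. 56th STOC (2024), arXiv:2311.02774 [Pratt2024SCC], Thm. 1.9, Cor. 1.11 and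
Cor. 1.12 (p. 4 of the arXiv version) as the named facts `pratt2024_thm_1_9`,
`pratt2024_cor_1_11`, `pratt2024_cor_1_12`. Everything in this file is PROVED.

> **Corollary 1.12.** If the set cover conjecture is true, then for every `k`,
> `R(T_k) ≥ 8^k · binom(3k,k) binom(2k,k) / 27^k ≥ (2/9) · 8^k · k^{-1}`.

The source prints no proof ("We now highlight some more-or-less immediate consequences of
Theorem 1.9", p. 4). The argument is: if `R(T_k) < B_k := 8^k binom(3k,k) binom(2k,k) / 27^k`
then `R̃(T_k) ≤ R(T_k) < B_k`, so for a suitable `ε > 0` the base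
`b_k(ε) = (R̃(T_k) + ε) 27^k / (binom(3k,k) binom(2k,k))` of Theorem 1.9 is `< 8^k` and Balanced
Tripartitioning is solvable in randomised time `O(c^n)` with `c = b_k(ε)^{1/k} < 8`; by the
reduction of `s`-Set Cover to Balanced Tripartitioning in the proof of Cor. 1.10 (pp. 6–7:
downward closure, dynamic programming over disjoint unions in time `binom(n, n/3) · poly(n)`,
guessing the `3s` boundary elements, one call on a universe of size `n − 3s`) this gives an
`O(2^{(1−ε')n})` randomised algorithm for `s`-Set Cover for every `s`, contradicting the Set
Cover Conjecture.

## Content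

* `asymptoticRank_le_tensorRank` — `R̃(t) ≤ R(t)` (the `N = 1` term of the infimum, transported
  along `t^{⊗1} ≅ t`), and `one_le_tensorRank_of_apply_ne_zero`.
* The arithmetic half of Cor. 1.12 (its second printed inequality), PROVED:
  `choose_mul_choose_mul_factorial_cube` (`binom(3k,k) binom(2k,k) (k!)^3 = (3k)!`),
  `two_mul_pow_mul_factorial_cube_le` (`2 · 27^k · (k!)^3 ≤ 9k · (3k)!` for `k ≥ 1`, induction:
  the ratio test reduces to `9k(k+1) ≤ (3k+1)(3k+2)`), and
  `pratt2024_cor_1_12_numerical : (2/9) · 8^k / k ≤ 8^k · binom(3k,k) binom(2k,k) / 27^k`.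
* The reduction of Cor. 1.12 to Theorem 1.9, PROVED as implications whose remaining hypothesis
  is the hardness half of the printed argument, stated inline (it is NOT vendored as a named
  fact): `pratt2024_asymptoticRank_bound_of_hardness` (Thm. 1.9 and "no randomised `O(c^n)`
  algorithm for Balanced Tripartitioning with `c < 8`" give `B_k ≤ R̃(T_k)` for `k ≥ 1`) and
  `pratt2024_cor_1_12_of_hardness` (whence `pratt2024_cor_1_12`, the case `k = 0` being
  `1 ≤ R(T_0)`); and, from the same two hypotheses, the printed Cor. 1.11 for `0 < ε < 8`,
  `pratt2024_cor_1_11_printed_of_hardness` (via `pratt2024_cor_1_12_numerical` and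
  `k · ((8 − ε)/8)^k → 0`), whence the named fact `pratt2024_cor_1_11` (corrected transcription)
  under the same two hypotheses, `pratt2024_cor_1_11_of_hardness`.
* A remark on the LITERAL reading of Cor. 1.11 ("for every `ε > 0` … `R̃(T_k) > (8 − ε)^k`"
  with `ε` unrestricted), PROVED: for `ε > 16` and even `k` the inequality `(8 − ε)^k < R̃(T_k)`
  contradicts the trivial bound `R̃(T_k) ≤ R(T_k) ≤ binom(3k,k)^3 ≤ 512^k`, so the literal
  conclusion `∀ ε > 0, ∃ k₀, ∀ k ≥ k₀, (8 − ε)^k < R̃(T_k)` is false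
  (`not_forall_eps_eventually_pow_lt_asymptoticRank`, also `…_inlined` in the spelling of route
  `MatrixMultiplication/TripartitionBridge`, whose item `SccPrice` takes this statement as a
  hypothesis), and the literal implication `SetCoverConjecture → …` is equivalent to
  `¬ SetCoverConjecture` (`pratt2024_cor_1_11_literal_iff_not_setCoverConjecture`). That literal
  implication was the body of the named fact `pratt2024_cor_1_11` as first vendored (2026-08);
  the printed corollary is meant for `0 < ε < 8` — the corrected transcription, see the
  *Correction* section of `PrattTripartitionBounds.lean` — and in that range it follows from
  `B_k ≤ R̃(T_k)` and `pratt2024_cor_1_12_numerical` (`pratt2024_cor_1_11_printed_of_hardness`).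

* The tensor identity behind the evaluation step of the proof of Thm. 1.9 (p. 6:
  "`T_k^{⊗r} = ∑_{(a,b,c) ∈ X³ : a ∨ b ∨ c = 1^{3rk}} X_a Y_b Z_c`", `X` = block-balanced sets),
  PROVED: `TripartitionIndex.blockEquiv`, `TripartitionIndex.blockUnion` (Pratt's `X` is its
  range; `mem_blockUnion`, `disjoint_blockUnion`, `blockUnion_injective`),
  `kroneckerPow_tripartitionTensor` (`T_k^{⊗r} = T_{kr} ∘ blockUnion³`),
  `tripartitionTensor_restrictsTo_kroneckerPow` (`T_{kr} ≥ T_k^{⊗r}`) and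
  `tensorRank_kroneckerPow_tripartitionTensor_le` (`R(T_k^{⊗r}) ≤ R(T_{kr})`).
* The count behind the success probability `p` of the proof of Thm. 1.9 and the constant of
  Cor. 1.12, PROVED: `TripartitionIndex.tripartitionEquiv` (ordered balanced tripartitions
  `(S, T, U)` of `[3k]` ≃ pairs `(S, T)` with `T` a `k`-subset of `Sᶜ`; `U = (S ∪ T)ᶜ`,
  `eq_compl_union`) and `TripartitionIndex.card_tripartitions`: there are exactly
  `binom(3k,k) · binom(2k,k)` of them (the support size of `T_k`).

## References

* [Pratt2024SCC] K. Pratt, STOC 2024, doi:10.1145/3618260.3649620, arXiv:2311.02774 — Thm. 1.9,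
  Cor. 1.10 (proof, pp. 6–7), Cor. 1.11, Cor. 1.12 (p. 4).
-/

noncomputable section

open scoped BigOperators

namespace Literature.Computability.AlgebraicComplexity

universe u

/-! ### `R̃ ≤ R` and `R ≥ 1` for non-zero tensors -/

section General

variable {K : Type u} [CommSemiring K] {ι κ μ : Type*} [Fintype ι] [Fintype κ] [Fintype μ]

/-- `R̃(t) ≤ R(t)`: the `N = 1` term of the infimum defining `R̃`, with `R(t^{⊗1}) = R(t)` by
relabelling along `(Fin 1 → ι) ≃ ι`. [folklore] -/
theorem asymptoticRank_le_tensorRank (t : ι → κ → μ → K) :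
    asymptoticRank t ≤ tensorRank t := by
  have h := asymptoticRank_le_tensorRank_pow_one t
  have e : kroneckerPow t 1 = fun a b c =>
      t (Equiv.funUnique (Fin 1) ι a) (Equiv.funUnique (Fin 1) κ b)
        (Equiv.funUnique (Fin 1) μ c) := by
    funext a b c
    simp [kroneckerPow_apply]
  rwa [e, tensorRank_reindex] at h

/-- A tensor with a non-zero entry has rank at least `1` (for finite formats the infimum
defining `tensorRank` is attained, and the empty sum of triads is `0`). [folklore] -/
theorem one_le_tensorRank_of_apply_ne_zero {t : ι → κ → μ → K} {a : ι} {b : κ} {c : μ}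
    (h : t a b c ≠ 0) : 1 ≤ tensorRank t := by
  by_contra hlt
  obtain ⟨w, u, v, e⟩ := exists_triad_decomposition_tensorRank t
  have h0 : tensorRank t = 0 := by omega
  apply h
  have habc := congrFun (congrFun (congrFun e a) b) c
  rw [habc, sum_triad_apply]
  have : IsEmpty (Fin (tensorRank t)) := by rw [h0]; infer_instance
  simp

end General

/-! ### The arithmetic of Corollary 1.12: `binom(3k,k) binom(2k,k) ≥ (2/9) 27^k / k` -/

/-- `binom(3k,k) · binom(2k,k) · (k!)^3 = (3k)!` (the trinomial coefficient). [folklore] -/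
theorem choose_mul_choose_mul_factorial_cube (k : ℕ) :
    (3 * k).choose k * (2 * k).choose k * Nat.factorial k ^ 3 = Nat.factorial (3 * k) := by
  have h1 := Nat.choose_mul_factorial_mul_factorial (show k ≤ 3 * k by omega)
  have h2 := Nat.choose_mul_factorial_mul_factorial (show k ≤ 2 * k by omega)
  rw [show 3 * k - k = 2 * k by omega] at h1
  rw [show 2 * k - k = k by omega] at h2
  calc (3 * k).choose k * (2 * k).choose k * Nat.factorial k ^ 3
      = (3 * k).choose k * Nat.factorial k *
          ((2 * k).choose k * Nat.factorial k * Nat.factorial k) := by ring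
    _ = Nat.factorial (3 * k) := by rw [h2, h1]

/-- `2 · 27^k · (k!)^3 ≤ 9k · (3k)!` for `k ≥ 1`, i.e. `(3k)!/(k!)^3 ≥ (2/9) 27^k / k`
(equality at `k = 1`; the ratio of consecutive terms on the right is `3(3k+1)(3k+2)/(k+1)^2`,
on the left `27k/(k+1)`, and `27k(k+1) ≤ 3(3k+1)(3k+2)`). [cite: Pratt2024SCC, Cor. 1.12] -/
theorem two_mul_pow_mul_factorial_cube_le {k : ℕ} (hk : 1 ≤ k) :
    2 * 27 ^ k * Nat.factorial k ^ 3 ≤ 9 * k * Nat.factorial (3 * k) := by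
  induction k, hk using Nat.le_induction with
  | base => norm_num [Nat.factorial]
  | succ k _ ih =>
    have hf : Nat.factorial (3 * (k + 1)) =
        (3 * k + 1 + 1 + 1) * ((3 * k + 1 + 1) * ((3 * k + 1) * Nat.factorial (3 * k))) := by
      rw [show 3 * (k + 1) = 3 * k + 1 + 1 + 1 by ring, Nat.factorial_succ, Nat.factorial_succ,
        Nat.factorial_succ]
    calc 2 * 27 ^ (k + 1) * Nat.factorial (k + 1) ^ 3
        = 27 * (k + 1) ^ 3 * (2 * 27 ^ k * Nat.factorial k ^ 3) := by
          rw [Nat.factorial_succ]; ring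
      _ ≤ 27 * (k + 1) ^ 3 * (9 * k * Nat.factorial (3 * k)) := Nat.mul_le_mul_left _ ih
      _ = 27 * (k + 1) ^ 3 * (9 * k) * Nat.factorial (3 * k) := by ring
      _ ≤ (27 * (k + 1) ^ 3 * (9 * k) + 54 * (k + 1) ^ 2) * Nat.factorial (3 * k) :=
          Nat.mul_le_mul_right _ (Nat.le_add_right _ _)
      _ = 9 * (k + 1) * Nat.factorial (3 * (k + 1)) := by rw [hf]; ring

/-- **Pratt, Corollary 1.12, second inequality**:
`8^k · binom(3k,k) binom(2k,k) / 27^k ≥ (2/9) · 8^k · k^{-1}` for `k ≥ 1` (pure arithmetic: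
`binom(3k,k) binom(2k,k) = (3k)!/(k!)^3 ≥ (2/9) 27^k / k`). [cite: Pratt2024SCC, Cor. 1.12] -/
theorem pratt2024_cor_1_12_numerical {k : ℕ} (hk : 1 ≤ k) :
    (2 / 9 : ℝ) * 8 ^ k / k ≤ (8 : ℝ) ^ k * ((3 * k).choose k * (2 * k).choose k) / 27 ^ k := by
  have hN : (2 : ℝ) * 27 ^ k * (Nat.factorial k : ℝ) ^ 3 ≤ 9 * k * (Nat.factorial (3 * k) : ℝ) := by
    exact_mod_cast two_mul_pow_mul_factorial_cube_le hk
  have hC : ((3 * k).choose k : ℝ) * ((2 * k).choose k) * (Nat.factorial k : ℝ) ^ 3 =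
      (Nat.factorial (3 * k) : ℝ) := by
    exact_mod_cast choose_mul_choose_mul_factorial_cube k
  have hkpos : (0 : ℝ) < k := Nat.cast_pos.2 (by omega)
  have hfac : (0 : ℝ) < (Nat.factorial k : ℝ) ^ 3 := by positivity
  rw [div_le_div_iff₀ hkpos (by positivity)]
  refine le_of_mul_le_mul_right ?_ hfac
  calc (2 / 9 : ℝ) * 8 ^ k * 27 ^ k * (Nat.factorial k : ℝ) ^ 3
      = 8 ^ k / 9 * (2 * 27 ^ k * (Nat.factorial k : ℝ) ^ 3) := by ring
    _ ≤ 8 ^ k / 9 * (9 * k * (Nat.factorial (3 * k) : ℝ)) := by gcongr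
    _ = 8 ^ k * (Nat.factorial (3 * k) : ℝ) * k := by ring
    _ = 8 ^ k * ((3 * k).choose k * (2 * k).choose k) * k * (Nat.factorial k : ℝ) ^ 3 := by
        rw [← hC]; ring

/-! ### Corollary 1.12 from Theorem 1.9 and the hardness of Balanced Tripartitioning -/

open FineGrained

/-- The core of Pratt's argument for Cor. 1.11 / 1.12, from **Theorem 1.9** (`pratt2024_thm_1_9`)
and the hardness half — "Balanced Tripartitioning has no randomised `O(c^n)`-time algorithm for
any `c < 8`" (under SCC this is the reduction in the proof of Cor. 1.10, pp. 6–7; here an explicit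
hypothesis) —: `8^k binom(3k,k) binom(2k,k) / 27^k ≤ R̃(T_k)` for `k ≥ 1`. Indeed otherwise some
`ε > 0` has `b_k(ε) < 8^k`, and Theorem 1.9 runs in time `O(b_k(ε)^{n/k}) = O(c^n)` with
`c = b_k(ε)^{1/k} < 8`. [cite: Pratt2024SCC, Cor. 1.12 and proof of Cor. 1.10] -/
theorem pratt2024_asymptoticRank_bound_of_hardness (h19 : pratt2024_thm_1_9) {k : ℕ} (hk : 1 ≤ k)
    (hBT : ∀ c : ℝ, 0 < c → c < 8 → ¬ BalancedTripartitioning.RandInTimeO fun n : ℕ => c ^ n) :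
    (8 : ℝ) ^ k * ((3 * k).choose k * (2 * k).choose k) / 27 ^ k ≤
      asymptoticRank (tripartitionTensor ℂ k) := by
  by_contra hlt
  push Not at hlt
  have hDpos : (0 : ℝ) < (3 * k).choose k * (2 * k).choose k := by
    have h1 : (0 : ℝ) < (3 * k).choose k := by exact_mod_cast Nat.choose_pos (by omega)
    have h2 : (0 : ℝ) < (2 * k).choose k := by exact_mod_cast Nat.choose_pos (by omega)
    positivity
  have h27 : (0 : ℝ) < 27 ^ k := by positivity
  -- a margin `ε` with `b_k(ε) < 8^k`
  obtain ⟨ε, hεpos, hε⟩ : ∃ ε : ℝ, 0 < ε ∧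
      (asymptoticRank (tripartitionTensor ℂ k) + ε) * 27 ^ k /
        ((3 * k).choose k * (2 * k).choose k) < 8 ^ k := by
    refine ⟨(8 ^ k * ((3 * k).choose k * (2 * k).choose k) / 27 ^ k -
      asymptoticRank (tripartitionTensor ℂ k)) / 2, by linarith, ?_⟩
    rw [div_lt_iff₀ hDpos]
    have hlt' : asymptoticRank (tripartitionTensor ℂ k) +
        (8 ^ k * ((3 * k).choose k * (2 * k).choose k) / 27 ^ k -
          asymptoticRank (tripartitionTensor ℂ k)) / 2 <
        8 ^ k * ((3 * k).choose k * (2 * k).choose k) / 27 ^ k := by linarith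
    calc (asymptoticRank (tripartitionTensor ℂ k) +
          (8 ^ k * ((3 * k).choose k * (2 * k).choose k) / 27 ^ k -
            asymptoticRank (tripartitionTensor ℂ k)) / 2) * 27 ^ k
        < 8 ^ k * ((3 * k).choose k * (2 * k).choose k) / 27 ^ k * 27 ^ k := by gcongr
      _ = 8 ^ k * ((3 * k).choose k * (2 * k).choose k) := div_mul_cancel₀ _ h27.ne'
  have hb8 : prattBase k ε < 8 ^ k := by rw [prattBase_def]; exact hε
  have hb0 : 0 < prattBase k ε := prattBase_pos k hεpos
  have hk0 : k ≠ 0 := by omega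
  have hkpos : (0 : ℝ) < k := Nat.cast_pos.2 (by omega)
  -- `c = b_k(ε)^{1/k} ∈ (0, 8)`
  have hc0 : 0 < prattBase k ε ^ ((k : ℝ)⁻¹) := Real.rpow_pos_of_pos hb0 _
  have hc8 : prattBase k ε ^ ((k : ℝ)⁻¹) < 8 := by
    have h8 : ((8 : ℝ) ^ k) ^ ((k : ℝ)⁻¹) = 8 := Real.pow_rpow_inv_natCast (by norm_num) hk0
    calc prattBase k ε ^ ((k : ℝ)⁻¹) < ((8 : ℝ) ^ k) ^ ((k : ℝ)⁻¹) :=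
          Real.rpow_lt_rpow hb0.le hb8 (inv_pos.2 hkpos)
      _ = 8 := h8
  -- `b_k(ε)^{n/k} = c^n`
  have hfun : (fun n : ℕ => prattBase k ε ^ ((n : ℝ) / k)) =
      fun n : ℕ => (prattBase k ε ^ ((k : ℝ)⁻¹)) ^ n := by
    funext n
    rw [← Real.rpow_natCast, ← Real.rpow_mul hb0.le, div_eq_inv_mul]
  have h := h19 k hk ε hεpos
  rw [hfun] at h
  exact hBT _ hc0 hc8 h

/-- **Pratt, Corollary 1.12 from Theorem 1.9**: given `pratt2024_thm_1_9` and the hardness of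
Balanced Tripartitioning under the Set Cover Conjecture (no randomised `O(c^n)` algorithm for any
`c < 8`; the reduction in the proof of Cor. 1.10, here an explicit hypothesis), the named fact
`pratt2024_cor_1_12` holds: for `k ≥ 1` by `pratt2024_asymptoticRank_bound_of_hardness` and
`R̃ ≤ R`; for `k = 0` the bound is `1 ≤ R(T_0)` (`T_0` is the non-zero `1 × 1 × 1` tensor).
[cite: Pratt2024SCC, Cor. 1.12] -/
theorem pratt2024_cor_1_12_of_hardness (h19 : pratt2024_thm_1_9)
    (hBT : SetCoverConjecture → ∀ c : ℝ, 0 < c → c < 8 →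
      ¬ BalancedTripartitioning.RandInTimeO fun n : ℕ => c ^ n) :
    pratt2024_cor_1_12 := by
  intro hscc k
  rcases Nat.eq_zero_or_pos k with rfl | hk
  · have hidx : TripartitionIndex 0 := ⟨∅, by simp⟩
    have h1 : 1 ≤ tensorRank (tripartitionTensor ℂ 0) :=
      one_le_tensorRank_of_apply_ne_zero (a := hidx) (b := hidx) (c := hidx)
        (by rw [tripartitionTensor_zero]; exact one_ne_zero)
    have h1' : (1 : ℝ) ≤ tensorRank (tripartitionTensor ℂ 0) := by exact_mod_cast h1
    simpa using h1'
  · exact (pratt2024_asymptoticRank_bound_of_hardness h19 hk (hBT hscc)).trans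
      (asymptoticRank_le_tensorRank _)

/-- **The printed Corollary 1.11** ("for every `ε > 0`, for all sufficiently large `k`,
`R̃(T_k) > (8 − ε)^k`", meaningful for `0 < ε < 8`) from the same two hypotheses as
`pratt2024_cor_1_12_of_hardness`: `R̃(T_k) ≥ 8^k binom(3k,k) binom(2k,k) / 27^k ≥ (2/9) 8^k / k`
(`pratt2024_asymptoticRank_bound_of_hardness`, `pratt2024_cor_1_12_numerical`) and
`k · ((8 − ε)/8)^k → 0`. [cite: Pratt2024SCC, Cor. 1.11] -/
theorem pratt2024_cor_1_11_printed_of_hardness (h19 : pratt2024_thm_1_9)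
    (hBT : SetCoverConjecture → ∀ c : ℝ, 0 < c → c < 8 →
      ¬ BalancedTripartitioning.RandInTimeO fun n : ℕ => c ^ n)
    (hscc : SetCoverConjecture) {ε : ℝ} (hε : 0 < ε) (hε8 : ε < 8) :
    ∃ k₀ : ℕ, ∀ k : ℕ, k₀ ≤ k → ((8 : ℝ) - ε) ^ k < asymptoticRank (tripartitionTensor ℂ k) := by
  have hr0 : (0 : ℝ) ≤ (8 - ε) / 8 := div_nonneg (by linarith) (by norm_num)
  have hr1 : (8 - ε) / 8 < 1 := by rw [div_lt_one (by norm_num)]; linarith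
  have ht := tendsto_self_mul_const_pow_of_lt_one hr0 hr1
  have hev : ∀ᶠ k : ℕ in Filter.atTop, (k : ℝ) * ((8 - ε) / 8) ^ k < 2 / 9 :=
    Filter.Tendsto.eventually_lt_const (show (0 : ℝ) < 2 / 9 by norm_num) ht
  obtain ⟨k₀, hk₀⟩ := Filter.eventually_atTop.1 hev
  refine ⟨max k₀ 1, fun k hk => ?_⟩
  have hk1 : 1 ≤ k := le_of_max_le_right hk
  have hsmall := hk₀ k (le_of_max_le_left hk)
  have hB := pratt2024_asymptoticRank_bound_of_hardness h19 hk1 (hBT hscc)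
  have hnum := pratt2024_cor_1_12_numerical hk1
  have hkpos : (0 : ℝ) < k := Nat.cast_pos.2 (by omega)
  have h8k : (0 : ℝ) < 8 ^ k := by positivity
  calc ((8 : ℝ) - ε) ^ k = 8 ^ k * ((8 - ε) / 8) ^ k := by rw [← mul_pow]; congr 1; ring
    _ = 8 ^ k / k * ((k : ℝ) * ((8 - ε) / 8) ^ k) := by
        rw [div_mul_eq_mul_div, eq_div_iff hkpos.ne']; ring
    _ < 8 ^ k / k * (2 / 9) := mul_lt_mul_of_pos_left hsmall (div_pos h8k hkpos)
    _ = (2 / 9 : ℝ) * 8 ^ k / k := by ring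
    _ ≤ (8 : ℝ) ^ k * ((3 * k).choose k * (2 * k).choose k) / 27 ^ k := hnum
    _ ≤ asymptoticRank (tripartitionTensor ℂ k) := hB

/-! ### The literal reading of Corollary 1.11 (`ε` unrestricted) -/

/-- With `ε > 0` unrestricted, "for all sufficiently large `k`, `(8 − ε)^k < R̃(T_k)`" is false
outright: for `ε = 1000` and even `k` it reads `992^k < R̃(T_k)`, contradicting
`R̃(T_k) ≤ R(T_k) ≤ binom(3k,k)^3 ≤ 512^k`. (This is the middle hypothesis of item `SccPrice` of
route `MatrixMultiplication/TripartitionBridge` and the conclusion of the literal transcription of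
Cor. 1.11 — the body of `pratt2024_cor_1_11` as first vendored, 2026-08; the printed corollary is
about `0 < ε < 8`, see `pratt2024_cor_1_11_printed_of_hardness`.) [cite: Pratt2024SCC, Cor. 1.11] -/
theorem not_forall_eps_eventually_pow_lt_asymptoticRank :
    ¬ ∀ ε : ℝ, 0 < ε → ∃ k₀ : ℕ, ∀ k : ℕ, k₀ ≤ k →
      ((8 : ℝ) - ε) ^ k < asymptoticRank (tripartitionTensor ℂ k) := by
  intro h
  obtain ⟨k₀, hk₀⟩ := h 1000 (by norm_num)
  have hk := hk₀ (2 * (k₀ + 1)) (by omega)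
  have hlhs : ((8 : ℝ) - 1000) ^ (2 * (k₀ + 1)) = 992 ^ (2 * (k₀ + 1)) := by
    rw [pow_mul, pow_mul]; norm_num
  rw [hlhs] at hk
  have hR : asymptoticRank (tripartitionTensor ℂ (2 * (k₀ + 1))) ≤
      (512 : ℝ) ^ (2 * (k₀ + 1)) := by
    refine (asymptoticRank_le_tensorRank _).trans ?_
    have h1 := tensorRank_le_card (tripartitionTensor ℂ (2 * (k₀ + 1)))
    rw [TripartitionIndex.card] at h1
    have h2 : (3 * (2 * (k₀ + 1))).choose (2 * (k₀ + 1)) ≤ 2 ^ (3 * (2 * (k₀ + 1))) :=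
      Nat.choose_le_two_pow _ _
    have h3 : tensorRank (tripartitionTensor ℂ (2 * (k₀ + 1))) ≤ 512 ^ (2 * (k₀ + 1)) := by
      calc tensorRank (tripartitionTensor ℂ (2 * (k₀ + 1)))
          ≤ (3 * (2 * (k₀ + 1))).choose (2 * (k₀ + 1)) *
              (3 * (2 * (k₀ + 1))).choose (2 * (k₀ + 1)) *
              (3 * (2 * (k₀ + 1))).choose (2 * (k₀ + 1)) := h1
        _ ≤ 2 ^ (3 * (2 * (k₀ + 1))) * 2 ^ (3 * (2 * (k₀ + 1))) * 2 ^ (3 * (2 * (k₀ + 1))) :=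
            Nat.mul_le_mul (Nat.mul_le_mul h2 h2) h2
        _ = 512 ^ (2 * (k₀ + 1)) := by
            rw [← pow_add, ← pow_add, show (512 : ℕ) = 2 ^ 9 by norm_num, ← pow_mul]
            ring_nf
    exact_mod_cast h3
  have hlt : (512 : ℝ) ^ (2 * (k₀ + 1)) < 992 ^ (2 * (k₀ + 1)) :=
    pow_lt_pow_left₀ (by norm_num) (by norm_num) (by omega)
  linarith

/-- The same in the inlined spelling of `T_k` used by route
`MatrixMultiplication/TripartitionBridge` (item `SccPrice`, whose middle hypothesis is therefore
inconsistent; `tripartitionTensor_def` is `rfl`). [cite: Pratt2024SCC, Cor. 1.11] -/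
theorem not_forall_eps_eventually_pow_lt_asymptoticRank_inlined :
    ¬ ∀ ε : ℝ, 0 < ε → ∃ k₀ : ℕ, ∀ k : ℕ, k₀ ≤ k → ((8 : ℝ) - ε) ^ k <
      asymptoticRank (fun S T U : {A : Finset (Fin (3 * k)) // A.card = k} =>
        if Disjoint S.1 T.1 ∧ Disjoint S.1 U.1 ∧ Disjoint T.1 U.1 then (1 : ℂ) else 0) :=
  not_forall_eps_eventually_pow_lt_asymptoticRank

/-- The LITERAL transcription of Cor. 1.11, "`SCC →` for every `ε > 0`, for all sufficiently
large `k`, `(8 − ε)^k < R̃(T_k)`" with `ε` unrestricted (the body of the named fact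
`pratt2024_cor_1_11` as first vendored, 2026-08), has a false conclusion
(`not_forall_eps_eventually_pow_lt_asymptoticRank`) and is therefore equivalent to the negation of
the Set Cover Conjecture; the printed corollary is about `0 < ε < 8`
(`pratt2024_cor_1_11_printed_of_hardness`; the corrected transcription, *Correction* section of
`PrattTripartitionBounds.lean`). Stated with the literal reading inlined, so that it does not
depend on the body of `pratt2024_cor_1_11`. [cite: Pratt2024SCC, Cor. 1.11] -/
theorem pratt2024_cor_1_11_literal_iff_not_setCoverConjecture :
    (SetCoverConjecture → ∀ ε : ℝ, 0 < ε → ∃ k₀ : ℕ, ∀ k : ℕ, k₀ ≤ k →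
      ((8 : ℝ) - ε) ^ k < asymptoticRank (tripartitionTensor ℂ k)) ↔ ¬ SetCoverConjecture :=
  ⟨fun h hscc => not_forall_eps_eventually_pow_lt_asymptoticRank (h hscc),
    fun h hscc => absurd hscc h⟩

/-- **Corollary 1.11 from Theorem 1.9**: the named fact `pratt2024_cor_1_11` (the corrected
transcription, `0 < ε < 8`) follows from `pratt2024_thm_1_9` and the hardness of Balanced
Tripartitioning under the Set Cover Conjecture (no randomised `O(c^n)` algorithm for any `c < 8`;
the reduction in the proof of Cor. 1.10, here an explicit hypothesis) —
`pratt2024_cor_1_11_printed_of_hardness` repackaged; this is the discharge path of the fact.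
[cite: Pratt2024SCC, Cor. 1.11] -/
theorem pratt2024_cor_1_11_of_hardness (h19 : pratt2024_thm_1_9)
    (hBT : SetCoverConjecture → ∀ c : ℝ, 0 < c → c < 8 →
      ¬ BalancedTripartitioning.RandInTimeO fun n : ℕ => c ^ n) :
    pratt2024_cor_1_11 :=
  fun hscc _ε hε hε8 => pratt2024_cor_1_11_printed_of_hardness h19 hBT hscc hε hε8

/-! ### `T_k^{⊗r}` inside `T_{kr}`: block unions (Pratt, proof of Theorem 1.9) -/

namespace TripartitionIndex

/-- Coordinates of `[3kr]` in `r` consecutive blocks of length `3k`: `(m, x) ↦ 3k · m + x`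
(the blocks `x_{1+3km}, …, x_{3k+3km}`, `m = 0, …, r − 1`, of the proof of Pratt's Thm. 1.9).
[cite: Pratt2024SCC, Thm. 1.9 (proof)] -/
def blockEquiv (k r : ℕ) : Fin r × Fin (3 * k) ≃ Fin (3 * (k * r)) :=
  finProdFinEquiv.trans (finCongr (by ring))

/-- The block union of an `r`-tuple of `k`-subsets of `[3k]`: the `kr`-subset of `[3kr]` meeting
the `m`-th block in (the translate of) the `m`-th set — Pratt's set `X` of block-balanced
`x ∈ {0,1}^{3rk}` is the range of this map. [cite: Pratt2024SCC, Thm. 1.9 (proof)] -/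
def blockUnion {k r : ℕ} (a : Fin r → TripartitionIndex k) : TripartitionIndex (k * r) :=
  ⟨(Finset.univ.sigma fun m : Fin r => (a m).1).map
      ⟨fun p => blockEquiv k r (p.1, p.2), fun p q h => by
        obtain ⟨p₁, p₂⟩ := p
        obtain ⟨q₁, q₂⟩ := q
        have h' := (blockEquiv k r).injective h
        simp only [Prod.mk.injEq] at h'
        obtain ⟨rfl, rfl⟩ := h'
        rfl⟩,
    by
      rw [Finset.card_map, Finset.card_sigma, Finset.sum_congr rfl fun m _ => (a m).2,
        Finset.sum_const, Finset.card_univ, Fintype.card_fin, smul_eq_mul, Nat.mul_comm]⟩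

/-- Membership in a block union, blockwise. [cite: Pratt2024SCC, Thm. 1.9 (proof)] -/
theorem mem_blockUnion {k r : ℕ} (a : Fin r → TripartitionIndex k) (m : Fin r)
    (x : Fin (3 * k)) : blockEquiv k r (m, x) ∈ (blockUnion a).1 ↔ x ∈ (a m).1 := by
  unfold blockUnion
  simp only [Finset.mem_map, Finset.mem_sigma, Finset.mem_univ, true_and,
    Function.Embedding.coeFn_mk]
  constructor
  · rintro ⟨⟨m', x'⟩, hx', h⟩
    have h' := (blockEquiv k r).injective h
    simp only [Prod.mk.injEq] at h'
    obtain ⟨rfl, rfl⟩ := h'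
    exact hx'
  · intro hx
    exact ⟨⟨m, x⟩, hx, rfl⟩

/-- Membership in a block union, in the coordinates of `[3kr]`. [cite: Pratt2024SCC, Thm. 1.9 (proof)] -/
theorem mem_blockUnion_iff {k r : ℕ} (a : Fin r → TripartitionIndex k) (i : Fin (3 * (k * r))) :
    i ∈ (blockUnion a).1 ↔ ((blockEquiv k r).symm i).2 ∈ (a ((blockEquiv k r).symm i).1).1 := by
  conv_lhs => rw [← (blockEquiv k r).apply_symm_apply i]
  exact mem_blockUnion a _ _

/-- Block unions are disjoint iff they are disjoint blockwise. [cite: Pratt2024SCC, Thm. 1.9 (proof)] -/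
theorem disjoint_blockUnion {k r : ℕ} (a b : Fin r → TripartitionIndex k) :
    Disjoint (blockUnion a).1 (blockUnion b).1 ↔ ∀ m, Disjoint (a m).1 (b m).1 := by
  simp_rw [Finset.disjoint_left]
  constructor
  · intro h m x hxa hxb
    exact h ((mem_blockUnion a m x).2 hxa) ((mem_blockUnion b m x).2 hxb)
  · intro h i hia hib
    rw [mem_blockUnion_iff] at hia hib
    exact h _ hia hib

/-- `blockUnion` is injective (Pratt's `X` is in bijection with `binom([3k],k)^r`).
[cite: Pratt2024SCC, Thm. 1.9 (proof)] -/
theorem blockUnion_injective (k r : ℕ) :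
    Function.Injective (blockUnion : (Fin r → TripartitionIndex k) → TripartitionIndex (k * r)) := by
  intro a b h
  funext m
  apply Subtype.ext
  ext x
  rw [← mem_blockUnion a m x, ← mem_blockUnion b m x, h]

end TripartitionIndex

section Blocks

variable {K : Type u} [CommSemiring K]

open TripartitionIndex

/-- **`T_k^{⊗r}` is `T_{kr}` on block unions** (Pratt, proof of Thm. 1.9:
"`T_k^{⊗r} = ∑_{(a,b,c) ∈ X³ : a ∨ b ∨ c = 1^{3rk}} X_a Y_b Z_c`"): three `r`-tuples of `k`-sets are
blockwise pairwise disjoint iff their block unions are pairwise disjoint.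
[cite: Pratt2024SCC, Thm. 1.9 (proof)] -/
theorem kroneckerPow_tripartitionTensor (k r : ℕ) :
    kroneckerPow (tripartitionTensor K k) r = fun a b c =>
      tripartitionTensor K (k * r) (blockUnion a) (blockUnion b) (blockUnion c) := by
  funext a b c
  rw [kroneckerPow_apply]
  simp_rw [tripartitionTensor_apply]
  rw [Fintype.prod_boole]
  have hiff : (∀ i, Disjoint (a i).1 (b i).1 ∧ Disjoint (a i).1 (c i).1 ∧
      Disjoint (b i).1 (c i).1) ↔
      (Disjoint (blockUnion a).1 (blockUnion b).1 ∧ Disjoint (blockUnion a).1 (blockUnion c).1 ∧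
        Disjoint (blockUnion b).1 (blockUnion c).1) := by
    simp only [disjoint_blockUnion, forall_and]
  by_cases h : ∀ i, Disjoint (a i).1 (b i).1 ∧ Disjoint (a i).1 (c i).1 ∧ Disjoint (b i).1 (c i).1
  · rw [if_pos h, if_pos (hiff.1 h)]
  · rw [if_neg h, if_neg (mt hiff.2 h)]

/-- **`T_{kr} ≥ T_k^{⊗r}`** (restriction: zero out the variables of `T_{kr}` not indexed by block
unions and relabel), the tensor form of the identity above. [cite: Pratt2024SCC, Thm. 1.9 (proof)] -/
theorem tripartitionTensor_restrictsTo_kroneckerPow (k r : ℕ) :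
    TensorRestrictsTo (tripartitionTensor K (k * r)) (kroneckerPow (tripartitionTensor K k) r) := by
  rw [kroneckerPow_tripartitionTensor]
  exact tensorRestrictsTo_precomp _ _ _ _

/-- Hence `R(T_k^{⊗r}) ≤ R(T_{kr})`. [cite: Pratt2024SCC, Thm. 1.9 (proof)] -/
theorem tensorRank_kroneckerPow_tripartitionTensor_le (k r : ℕ) :
    tensorRank (kroneckerPow (tripartitionTensor K k) r) ≤
      tensorRank (tripartitionTensor K (k * r)) :=
  (tripartitionTensor_restrictsTo_kroneckerPow k r).tensorRank_le

end Blocks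

/-! ### Counting ordered balanced tripartitions (Pratt, proof of Theorem 1.9) -/

namespace TripartitionIndex

variable {k : ℕ}

/-- The complement of two disjoint `k`-subsets of `[3k]` has `k` elements. [folklore] -/
theorem card_compl_union {S T : Finset (Fin (3 * k))} (hS : S.card = k) (hT : T.card = k)
    (h : Disjoint S T) : ((S ∪ T)ᶜ).card = k := by
  rw [Finset.card_compl, Finset.card_union_of_disjoint h, hS, hT, Fintype.card_fin]
  omega

/-- In a balanced tripartition the third set is the complement of the other two. [folklore] -/
theorem eq_compl_union {S T U : Finset (Fin (3 * k))} (hS : S.card = k) (hT : T.card = k)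
    (hU : U.card = k) (hST : Disjoint S T) (hSU : Disjoint S U) (hTU : Disjoint T U) :
    U = (S ∪ T)ᶜ := by
  apply Finset.eq_of_subset_of_card_le
  · intro x hx
    rw [Finset.mem_compl, Finset.mem_union, not_or]
    exact ⟨fun hxS => Finset.disjoint_left.1 hSU hxS hx, fun hxT => Finset.disjoint_left.1 hTU hxT hx⟩
  · rw [card_compl_union hS hT hST, hU]

variable (k) in
/-- Ordered balanced tripartitions `(S, T, U)` of `[3k]` (pairwise disjoint `k`-sets) correspond to
pairs `(S, T)` with `T` a `k`-subset of the complement of `S` (`U = (S ∪ T)ᶜ` is determined).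
[cite: Pratt2024SCC, Thm. 1.9 (proof)] -/
def tripartitionEquiv :
    {x : TripartitionIndex k × TripartitionIndex k × TripartitionIndex k //
        Disjoint x.1.1 x.2.1.1 ∧ Disjoint x.1.1 x.2.2.1 ∧ Disjoint x.2.1.1 x.2.2.1} ≃
      Σ S : TripartitionIndex k, {T : Finset (Fin (3 * k)) // T ∈ Finset.powersetCard k S.1ᶜ} where
  toFun x := ⟨x.1.1, ⟨x.1.2.1.1, by
    rw [Finset.mem_powersetCard]
    refine ⟨fun i hi => ?_, x.1.2.1.2⟩
    rw [Finset.mem_compl]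
    exact fun hiS => Finset.disjoint_left.1 x.2.1 hiS hi⟩⟩
  invFun y := ⟨(y.1, ⟨y.2.1, (Finset.mem_powersetCard.1 y.2.2).2⟩,
      ⟨(y.1.1 ∪ y.2.1)ᶜ, card_compl_union y.1.2 (Finset.mem_powersetCard.1 y.2.2).2
        (Finset.disjoint_left.2 fun i hiS hiT => Finset.mem_compl.1
          ((Finset.mem_powersetCard.1 y.2.2).1 hiT) hiS)⟩), by
    refine ⟨Finset.disjoint_left.2 fun i hiS hiT => Finset.mem_compl.1
        ((Finset.mem_powersetCard.1 y.2.2).1 hiT) hiS, ?_, ?_⟩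
    · exact Finset.disjoint_left.2 fun i hiS hiC =>
        (Finset.mem_compl.1 hiC) (Finset.mem_union_left _ hiS)
    · exact Finset.disjoint_left.2 fun i hiT hiC =>
        (Finset.mem_compl.1 hiC) (Finset.mem_union_right _ hiT)⟩
  left_inv x := by
    obtain ⟨⟨S, T, U⟩, hST, hSU, hTU⟩ := x
    simp only
    congr
    exact (eq_compl_union S.2 T.2 U.2 hST hSU hTU).symm
  right_inv y := by
    obtain ⟨S, T, hT⟩ := y
    rfl

variable (k) in
/-- **There are `binom(3k,k) · binom(2k,k)` ordered balanced tripartitions of `[3k]`** (the support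
size of `T_k`; Pratt, proof of Thm. 1.9: "`X` contains `(binom(3k,k) binom(2k,k))^r` (ordered)
tripartitions"). [cite: Pratt2024SCC, Thm. 1.9 (proof)] -/
theorem card_tripartitions :
    Fintype.card {x : TripartitionIndex k × TripartitionIndex k × TripartitionIndex k //
        Disjoint x.1.1 x.2.1.1 ∧ Disjoint x.1.1 x.2.2.1 ∧ Disjoint x.2.1.1 x.2.2.1} =
      (3 * k).choose k * (2 * k).choose k := by
  rw [Fintype.card_congr (tripartitionEquiv k), Fintype.card_sigma]
  have h : ∀ S : TripartitionIndex k,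
      Fintype.card {T : Finset (Fin (3 * k)) // T ∈ Finset.powersetCard k S.1ᶜ} =
        (2 * k).choose k := by
    intro S
    rw [Fintype.card_coe, Finset.card_powersetCard, Finset.card_compl, S.2, Fintype.card_fin]
    congr 1
    omega
  simp_rw [h]
  rw [Finset.sum_const, Finset.card_univ, TripartitionIndex.card, smul_eq_mul]

end TripartitionIndex

end Literature.Computability.AlgebraicComplexity
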